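import Literature.NumberTheory.Sieve.MaynardNFCounting2
import Literature.NumberTheory.Sieve.MaynardNFParams
import Literature.NumberTheory.Sieve.MaynardNFSmooth
import HarnessLib

/-!
# The Maynard–Tao sieve over `𝓞_K`: parameters, Proposition 2.1 as statements, and Corollary 2.6

Topic `Literature/NumberTheory/Sieve`. A. Castillo, C. Hall, R. J. Lemke Oliver, P. Pollack,
L. Thompson, *Bounded gaps between primes in number fields and function fields*, Proc. AMS 143 (2015)
= arXiv:1403.5808, §2.2 (the parameters "`𝔴 := ∏_{|𝔭|<D₀} 𝔭` for some `D₀` tending slowly to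
infinity with `N`, say `D₀ = log log log N`", "`R = |A(N)|^{θ/2−δ}`", the weights
`y_𝔯 = F(log|𝔯₁|/log R, …)`), Proposition 2.1 (the asymptotics for `S₁`, `S₂`) and Corollary 2.6
(its proof: "if `S := S₂ − ρS₁ > 0` for a certain `N`, then there are more than `ρ` primes among the
`α + hᵢ` … `S = (φ(𝔴)^k/|𝔴|^{k+1}) |A(N)| (c_A log R)^k ((c_A log R)|P(N)|/|A(N)| ∑ J − ρ I + o(1))`
… `Δ := c_A lim |P(N)| log|A(N)|/|A(N)|`"). This is the number-field analogue of the tree's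
`Sieve/MaynardSieve.lean`. Everything here is PROVED; the two asymptotic statements of
Proposition 2.1 are DEFINITIONS (predicates `S1Asymptotic`, `S2Asymptotic` with all data explicit)
consumed as hypotheses by the deduction — no named facts.

* parameters: `paramD0 N = log log log N`, `primesLE K D` (the primes of norm `≤ D`),
  `paramW K N = ∏_{N𝔭 ≤ D₀(N)} 𝔭`, `nfR K θ δ N = |A(N)|^{θ/2−δ}`, the smooth coefficients
  `smoothY` (`y_𝔯 = F(log N𝔯ᵢ/log R)` on good tuples of the box), the main term
  `nfMainTerm = φ(𝔴)^k |A(N)| (c_K log R)^k/N𝔴^{k+1}` (`c_K = dedekindZeta_residue K`), the sieve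
  sums `sieveS1`, `sieveS2` (= `MaynardNFCounting.S1`, `MaynardNFCounting2.S2` at these data);
* `S1Asymptotic`, `S2Asymptotic` — Proposition 2.1 as printed (`o(𝔐)` form);
* `sum_sieveS2_sub_mul_sieveS1` (`S = ∑_α (#{i : α+hᵢ prime} − ρ) wt(α)²`),
  `exists_lt_card_of_sieve_pos`, **`infinite_setOf_lt_card_of_asymptotics`** — Corollary 2.6:
  from the two asymptotics, `Δ = 1` (in the form `c_K |P(N)| log|A(N)|/|A(N)| → 1`), `|A(N)| → ∞`,
  `𝔐 > 0` eventually and `ρ I_k(F) < (θ/2 − δ) ∑ J_k^{(m)}(F)`: infinitely many `α` with more than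
  `ρ` primes among the `α + hᵢ`.

## References

* Castillo–Hall–Lemke Oliver–Pollack–Thompson, arXiv:1403.5808, §2.2 (parameters), Proposition 2.1,
  Corollary 2.6 and its proof (§2.3). [CastilloEtAl2015]
* J. Maynard, *Small gaps between primes*, Ann. of Math. 181 (2015), §4 (Prop. 4.1, 4.2).
  [MaynardAnnals2015]
-/

noncomputable section

open Finset Filter Topology Asymptotics NumberField IsDedekindDomain
open scoped NumberField Classical

namespace Literature.NumberTheory.Sieve.MaynardNF

open Literature.NumberTheory.LFunctions Literature.NumberTheory.LFunctions.NumberField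
  Literature.NumberTheory.Sieve.SquarefreeIdeal Module

open scoped nonZeroDivisors

variable {K : Type*} [Field K] [NumberField K]
variable {k : ℕ}

/-! ### The parameters `D₀`, `𝔴`, `R` and the smooth coefficients -/

variable (K) in
/-- `R = |A(N)|^{θ/2 − δ}`. [cite: CastilloEtAl2015, Proposition 2.1 (R = |A(N)|^{θ/2−δ})] -/
def nfR (θ δ N : ℝ) : ℝ := (cardA K N : ℝ) ^ (θ / 2 - δ)

variable (K) in
/-- The common size `𝔐 = φ(𝔴)^k |A(N)| (c_K log R)^k / N𝔴^{k+1}` of the main terms of Proposition 2.1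
(`c_K = Res_{s=1} ζ_K`). [cite: CastilloEtAl2015, Proposition 2.1] -/
def nfMainTerm (k : ℕ) (θ δ N : ℝ) : ℝ :=
  idealTotient K (paramW K N) ^ k * cardA K N * (dedekindZeta_residue K * Real.log (nfR K θ δ N)) ^ k /
    (Ideal.absNorm (paramW K N) : ℝ) ^ (k + 1)

variable (K) in
/-- `S₁` of §2.2 at the data of Proposition 2.1: modulus `𝔴(N)`, level `R(N)`, weights from `smoothY`,
shifts `h`, class `v₀(N)`. [cite: CastilloEtAl2015, §2.2 (S₁) and Proposition 2.1] -/
def sieveS1 (k : ℕ) (h : Fin k → 𝓞 K) (θ δ : ℝ) (G : (Fin k → ℝ) → ℝ) (v₀ : ℝ → 𝓞 K) (N : ℝ) : ℝ :=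
  S1 K k (paramW K N) (nfR K θ δ N) (smoothY K k G (nfR K θ δ N) (paramW K N)) h (v₀ N) N

variable (K) in
/-- `S₂^{(m)}` of §2.2 at the data of Proposition 2.1. [cite: CastilloEtAl2015, §2.2 (S₂^(m)) and Proposition 2.1] -/
def sieveS2 (k : ℕ) (h : Fin k → 𝓞 K) (θ δ : ℝ) (G : (Fin k → ℝ) → ℝ) (v₀ : ℝ → 𝓞 K) (N : ℝ)
    (m : Fin k) : ℝ :=
  S2 K k (paramW K N) (nfR K θ δ N) (smoothY K k G (nfR K θ δ N) (paramW K N)) h (v₀ N) N m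

/-! ### Proposition 2.1 as statements -/

variable (K) in
/-- **Proposition 2.1, `S₁` part** (as printed: "`S₁ = (1 + o(1)) φ(𝔴)^k |A(N)| (c_A log R)^k I_k(F)/|𝔴|^{k+1}`"),
for the shifts `h`, parameters `θ, δ`, test function `F = G · 1_{R_k}` and classes `v₀ = v₀(N)`;
rendered as `S₁ − 𝔐 I_k(F) = o(𝔐)`. [cite: CastilloEtAl2015, Proposition 2.1 (S₁)] -/
def S1Asymptotic (k : ℕ) (h : Fin k → 𝓞 K) (θ δ : ℝ) (G : (Fin k → ℝ) → ℝ) (v₀ : ℝ → 𝓞 K) : Prop :=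
  (fun N : ℝ => sieveS1 K k h θ δ G v₀ N -
      nfMainTerm K k θ δ N * maynardI k ((maynardSimplex k).indicator G)) =o[atTop]
    nfMainTerm K k θ δ

variable (K) in
/-- **Proposition 2.1, `S₂` part** (as printed:
"`S₂ = (1 + o(1)) φ(𝔴)^k |P(N)| (c_A log R)^{k+1} ∑ J_k^{(m)}(F)/|𝔴|^{k+1}`", componentwise in `m`):
`S₂^{(m)} − 𝔐 · (c_K log R · |P(N)|/|A(N)|) · J_k^{(m)}(F) = o(𝔐)`.
[cite: CastilloEtAl2015, Proposition 2.1 (S₂) and Lemma 2.3] -/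
def S2Asymptotic (k : ℕ) (h : Fin k → 𝓞 K) (θ δ : ℝ) (G : (Fin k → ℝ) → ℝ) (v₀ : ℝ → 𝓞 K)
    (m : Fin k) : Prop :=
  (fun N : ℝ => sieveS2 K k h θ δ G v₀ N m -
      nfMainTerm K k θ δ N * (dedekindZeta_residue K * Real.log (nfR K θ δ N) *
        (primesA K N : ℝ) / cardA K N) * maynardJ k m ((maynardSimplex k).indicator G)) =o[atTop]
    nfMainTerm K k θ δ

/-! ### Corollary 2.6: positivity -/

/-- **`S = ∑_α (∑ᵢ χ_P(α + hᵢ) − ρ) (∑_𝔡 λ_𝔡)²`**: the difference `∑ₘ S₂^{(m)} − ρ S₁` as a single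
sum of weights squared times `#{i : α + hᵢ prime} − ρ`.
[cite: CastilloEtAl2015, §2.2 ("Because each summand is non-negative…")] -/
theorem sum_S2_sub_mul_S1 (𝔴 : Ideal (𝓞 K)) (B : ℝ) (y : (Fin k → Ideal (𝓞 K)) → ℝ)
    (h : Fin k → 𝓞 K) (ν₀ : 𝓞 K) (N ρ : ℝ) :
    ∑ m, S2 K k 𝔴 B y h ν₀ N m - ρ * S1 K k 𝔴 B y h ν₀ N =
      ∑ α ∈ (regionF K N).filter (fun α => α - ν₀ ∈ 𝔴),
        (∑ 𝔡 ∈ (box K k B).filter (fun 𝔡 => ∀ i, α + h i ∈ 𝔡 i), lam K k B y 𝔡) ^ 2 *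
          ((((Finset.univ : Finset (Fin k)).filter fun i => Prime (α + h i)).card : ℝ) - ρ) := by
  unfold S2 S1
  rw [Finset.sum_comm, Finset.mul_sum, ← Finset.sum_sub_distrib]
  refine Finset.sum_congr rfl fun α _ => ?_
  rw [← Finset.sum_mul]
  have hchi : ∑ m, chiP (α + h m) = (((Finset.univ : Finset (Fin k)).filter fun i => Prime (α + h i)).card : ℝ) := by
    rw [Finset.card_eq_sum_ones, Nat.cast_sum, Finset.sum_filter]
    refine Finset.sum_congr rfl fun m _ => ?_
    rw [chiP_eq_ite]
    split_ifs <;> simp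
  rw [hchi]
  ring

/-- **Positivity** ("if `S₂ > ρS₁` then at least one `α ∈ A(N)` has more than `ρ` of the `α + hᵢ`
prime"). [cite: CastilloEtAl2015, §2.2] -/
theorem exists_lt_card_of_sieve_pos {𝔴 : Ideal (𝓞 K)} {B : ℝ} {y : (Fin k → Ideal (𝓞 K)) → ℝ}
    {h : Fin k → 𝓞 K} {ν₀ : 𝓞 K} {N ρ : ℝ}
    (hpos : 0 < ∑ m, S2 K k 𝔴 B y h ν₀ N m - ρ * S1 K k 𝔴 B y h ν₀ N) :
    ∃ α ∈ CastilloEtAl2015.box K N,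
      ρ < ((((Finset.univ : Finset (Fin k)).filter fun i => Prime (α + h i)).card : ℝ)) := by
  rw [sum_S2_sub_mul_S1] at hpos
  by_contra hcon
  push Not at hcon
  have : ∑ α ∈ (regionF K N).filter (fun α => α - ν₀ ∈ 𝔴),
      (∑ 𝔡 ∈ (box K k B).filter (fun 𝔡 => ∀ i, α + h i ∈ 𝔡 i), lam K k B y 𝔡) ^ 2 *
        ((((Finset.univ : Finset (Fin k)).filter fun i => Prime (α + h i)).card : ℝ) - ρ) ≤ 0 := by
    refine Finset.sum_nonpos fun α hα => mul_nonpos_of_nonneg_of_nonpos (sq_nonneg _) ?_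
    have hαbox : α ∈ CastilloEtAl2015.box K N := mem_regionF.1 (Finset.mem_filter.1 hα).1
    linarith [hcon α hαbox]
  linarith

/-- `log R = (θ/2 − δ) log|A(N)|` (for `|A(N)| > 0`). [folklore] -/
theorem log_nfR (θ δ : ℝ) {N : ℝ} (hA : 0 < (cardA K N : ℝ)) :
    Real.log (nfR K θ δ N) = (θ / 2 - δ) * Real.log (cardA K N) := by
  rw [nfR, Real.log_rpow hA]

/-- **Corollary 2.6 (the deduction from Proposition 2.1)**: assume the two asymptotics of
Proposition 2.1 for the data `(h, θ, δ, G, v₀)`, the limit `Δ = c_K lim |P(N)| log|A(N)|/|A(N)| = 1`,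
`|A(N)| → ∞`, and `𝔐(N) > 0` for large `N`. If `ρ I_k(F) < (θ/2 − δ) ∑ₘ J_k^{(m)}(F)`
(`F = G·1_{R_k}`), then infinitely many `α ∈ 𝓞_K` have more than `ρ` of the `α + hᵢ` prime:
"`S ≥ (φ(𝔴)^k/|𝔴|^{k+1})|A(N)|(c_A log R)^k I_k(F₀)(Δ(θ/2 − ε)(M_k − ε) − ρ + o(1))` … we get that
`S > 0` for large `N`", then positivity and the disjointness of the boxes `A(2^j N₀)`.
[cite: CastilloEtAl2015, Corollary 2.6 and its proof] -/
theorem infinite_setOf_lt_card_of_asymptotics {h : Fin k → 𝓞 K} {θ δ : ℝ}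
    {G : (Fin k → ℝ) → ℝ} {v₀ : ℝ → 𝓞 K}
    (hS1 : S1Asymptotic K k h θ δ G v₀) (hS2 : ∀ m, S2Asymptotic K k h θ δ G v₀ m)
    (hΔ : Tendsto (fun N : ℝ => dedekindZeta_residue K *
      ((primesA K N : ℝ) * Real.log (cardA K N) / cardA K N)) atTop (𝓝 1))
    (hA : Tendsto (fun N : ℝ => (cardA K N : ℝ)) atTop atTop)
    (hM : ∀ᶠ N : ℝ in atTop, 0 < nfMainTerm K k θ δ N)
    {ρ : ℝ} (hρ : ρ * maynardI k ((maynardSimplex k).indicator G) <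
      (θ / 2 - δ) * ∑ m, maynardJ k m ((maynardSimplex k).indicator G)) :
    {α : 𝓞 K | ρ < ((((Finset.univ : Finset (Fin k)).filter fun i => Prime (α + h i)).card : ℝ))}.Infinite := by
  set F := (maynardSimplex k).indicator G with hF
  set I := maynardI k F with hI
  set J := ∑ m, maynardJ k m F with hJ
  set e := θ / 2 - δ with he
  set c := dedekindZeta_residue K with hc
  set η := e * J - ρ * I with hη
  have hη0 : 0 < η := by rw [hη]; linarith
  -- the bracket `(c log R |P|/|A|) J − ρ I → e J − ρ I = η`
  set Bf : ℝ → ℝ := fun N =>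
    (c * Real.log (nfR K θ δ N) * (primesA K N : ℝ) / cardA K N) * J - ρ * I with hBf
  have hX : Tendsto (fun N : ℝ => c * Real.log (nfR K θ δ N) * (primesA K N : ℝ) / cardA K N)
      atTop (𝓝 e) := by
    have h2 := hΔ.const_mul e
    rw [mul_one] at h2
    refine h2.congr' ?_
    filter_upwards [hA.eventually_gt_atTop 0] with N hN
    rw [log_nfR θ δ hN]
    ring
  have hB : Tendsto Bf atTop (𝓝 η) := by
    have := (hX.mul_const J).sub_const (ρ * I)
    rw [hBf, hη]
    exact this
  -- `S(N) − 𝔐 B(N) = o(𝔐)`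
  have hS : (fun N : ℝ => (∑ m, sieveS2 K k h θ δ G v₀ N m - ρ * sieveS1 K k h θ δ G v₀ N) -
      nfMainTerm K k θ δ N * Bf N) =o[atTop] nfMainTerm K k θ δ := by
    have h2 : (fun N : ℝ => ∑ m, (sieveS2 K k h θ δ G v₀ N m -
        nfMainTerm K k θ δ N * (c * Real.log (nfR K θ δ N) * (primesA K N : ℝ) / cardA K N) *
          maynardJ k m F)) =o[atTop] nfMainTerm K k θ δ :=
      IsLittleO.sum fun m _ => hS2 m
    have h3 := h2.sub (hS1.const_mul_left ρ)
    refine h3.congr' ?_ EventuallyEq.rfl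
    filter_upwards with N
    simp only [hBf, hF, hI, hJ]
    rw [Finset.sum_sub_distrib, ← Finset.mul_sum]
    ring
  -- eventually `S(N) > 0`
  have hev : ∀ᶠ N : ℝ in atTop,
      0 < ∑ m, sieveS2 K k h θ δ G v₀ N m - ρ * sieveS1 K k h θ δ G v₀ N := by
    have h1 := hS.def (by positivity : (0 : ℝ) < η / 4)
    have h2 : ∀ᶠ N : ℝ in atTop, η / 2 < Bf N := hB.eventually (eventually_gt_nhds (by linarith))
    filter_upwards [h1, h2, hM] with N h1 h2 h3
    rw [Real.norm_eq_abs, Real.norm_eq_abs, abs_of_pos h3] at h1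
    have h4 := (abs_le.1 h1).1
    nlinarith [mul_lt_mul_of_pos_left h2 h3]
  -- conclude by positivity in each large box and disjointness of dyadic boxes
  obtain ⟨N₀, hN₀⟩ := Filter.eventually_atTop.1 hev
  refine CastilloEtAl2015.infinite_of_forall_exists_mem_box (N₀ := max N₀ 1) (by positivity)
    fun N hN => ?_
  exact exists_lt_card_of_sieve_pos (hN₀ N (le_trans (le_max_left _ _) hN))

/-! ### `|A(N)|`, `|P(N)|` and `Δ = 1` -/

/-- **`|A(N)|/(2N)^d → (1 − 2^{−d})/√|D_K|`** for totally real `K` ("`|A(N)| ∼ (2π)^{r₂}(2N)^d(1 − 1/2^d)/√|D|`",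
proof of Corollary 2.6; here from the uniform lattice-point count of §2.1 with error `O(N^{d−1})`).
[cite: CastilloEtAl2015, proof of Corollary 2.6 (|A(N)| ∼ …)] -/
theorem tendsto_cardA_div [IsTotallyReal K] :
    Tendsto (fun N : ℝ => (cardA K N : ℝ) / (2 * N) ^ finrank ℚ K) atTop
      (𝓝 ((1 - 2⁻¹ ^ finrank ℚ K) / √|(discr K : ℝ)|)) := by
  obtain ⟨C, hC⟩ := CastilloEtAl2015.abs_card_box_coset_sub_le_uniform K
  set d : ℕ := finrank ℚ K with hd
  have hd1 : 1 ≤ d := finrank_pos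
  have hdR : (0 : ℝ) < d := by exact_mod_cast finrank_pos
  set D : ℝ := √|(discr K : ℝ)| with hD
  have hD0 : 0 < D := Real.sqrt_pos.2 (abs_pos.2 (Int.cast_ne_zero.2 (discr_ne_zero K)))
  set L : ℝ := (1 - 2⁻¹ ^ d) / D with hL
  -- the count at `𝔮 = 1`
  have hcount : ∀ N : ℝ, 1 ≤ N → |(cardA K N : ℝ) - (2 ^ d - 1) * N ^ d / D| ≤ C * (1 + N ^ (d - 1)) := by
    intro N hN
    have hN0 : 0 < N := by linarith
    have h := hC 1 N hN 0
    have hcard : Nat.card {α : 𝓞 K // α ∈ CastilloEtAl2015.box K N ∧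
        α - 0 ∈ ((1 : (Ideal (𝓞 K))⁰) : Ideal (𝓞 K))} = cardA K N := by
      rw [cardA_eq_natCard]
      exact Nat.card_congr (Equiv.subtypeEquivRight fun α => by simp)
    rw [hcard] at h
    simp only [OneMemClass.coe_one, Ideal.one_eq_top, Ideal.absNorm_top, Nat.cast_one, one_mul,
      div_one] at h
    have hpow : (N ^ d : ℝ) ^ (1 - 1 / (d : ℝ)) = N ^ (d - 1) := by
      rw [← Real.rpow_natCast N d, ← Real.rpow_mul hN0.le, ← Real.rpow_natCast N (d - 1),
        Nat.cast_sub hd1, Nat.cast_one, mul_sub, mul_one, mul_one_div_cancel hdR.ne']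
    rwa [hpow] at h
  -- the difference is `O(1/N)`
  have hbound : ∀ᶠ N : ℝ in atTop, ‖(cardA K N : ℝ) / (2 * N) ^ d - L‖ ≤ (|C| * 2 / 2 ^ d) * N⁻¹ := by
    filter_upwards [eventually_ge_atTop (1 : ℝ)] with N hN
    have hN0 : 0 < N := by linarith
    have h2N : (0 : ℝ) < (2 * N) ^ d := by positivity
    have hkey : (cardA K N : ℝ) / (2 * N) ^ d - L =
        ((cardA K N : ℝ) - (2 ^ d - 1) * N ^ d / D) / (2 * N) ^ d := by
      rw [hL, mul_pow, sub_div, inv_pow]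
      field_simp
    rw [hkey, Real.norm_eq_abs, abs_div, abs_of_pos h2N]
    have h1 := hcount N hN
    have hNd : (0 : ℝ) < N ^ d := by positivity
    have hNd1 : N ^ (d - 1) * N = N ^ d := by rw [← pow_succ, Nat.sub_add_cancel hd1]
    rw [div_le_iff₀ h2N]
    calc |(cardA K N : ℝ) - (2 ^ d - 1) * N ^ d / D| ≤ C * (1 + N ^ (d - 1)) := h1
      _ ≤ |C| * (1 + N ^ (d - 1)) := mul_le_mul_of_nonneg_right (le_abs_self C) (by positivity)
      _ ≤ |C| * (2 * N ^ (d - 1)) := by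
          refine mul_le_mul_of_nonneg_left ?_ (abs_nonneg C)
          have : (1 : ℝ) ≤ N ^ (d - 1) := one_le_pow₀ hN
          linarith
      _ = |C| * 2 / 2 ^ d * N⁻¹ * (2 * N) ^ d := by
          rw [mul_pow]
          field_simp
          rw [← hNd1]
          ring
  have hlim : Tendsto (fun N : ℝ => (|C| * 2 / 2 ^ d) * N⁻¹) atTop (𝓝 0) := by
    simpa using tendsto_inv_atTop_zero.const_mul (|C| * 2 / 2 ^ d)
  have h0 : Tendsto (fun N : ℝ => (cardA K N : ℝ) / (2 * N) ^ d - L) atTop (𝓝 0) :=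
    squeeze_zero_norm' hbound hlim
  have := h0.add_const L
  simpa using this

/-- `|A(N)| → ∞`. [folklore] -/
theorem tendsto_cardA_atTop [IsTotallyReal K] :
    Tendsto (fun N : ℝ => (cardA K N : ℝ)) atTop atTop := by
  have h := tendsto_cardA_div (K := K)
  have hd : finrank ℚ K ≠ 0 := finrank_pos.ne'
  have hD : 0 < √|(discr K : ℝ)| := Real.sqrt_pos.2 (abs_pos.2 (Int.cast_ne_zero.2 (discr_ne_zero K)))
  have h2d : (0 : ℝ) < 1 - 2⁻¹ ^ finrank ℚ K := by
    rw [sub_pos]; exact pow_lt_one₀ (by norm_num) (by norm_num) hd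
  have hL : 0 < (1 - 2⁻¹ ^ finrank ℚ K) / √|(discr K : ℝ)| := div_pos h2d hD
  have h2N : Tendsto (fun N : ℝ => (2 * N) ^ finrank ℚ K) atTop atTop :=
    (tendsto_pow_atTop hd).comp (tendsto_id.const_mul_atTop (by norm_num : (0 : ℝ) < 2))
  have := h.pos_mul_atTop hL h2N
  refine this.congr' ?_
  filter_upwards [eventually_gt_atTop (0 : ℝ)] with N hN
  have : (0 : ℝ) < (2 * N) ^ finrank ℚ K := by positivity
  field_simp

/-- **The prime number theorem for `P(N)`** (p. 11: "Hence
`|P(N)| ∼ (w_K/(2^{r₁} h_K Reg_K))(1 − 1/2^d)(2N)^d/log((2N)^d)`", from Mitsui's generalized prime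
number theorem [Mitsui 1956] and the evaluation of its integral [Hinz 1981]), as a predicate; it enters
Corollary 2.6 as a HYPOTHESIS (`Δ = 1`). [cite: CastilloEtAl2015, proof of Corollary 2.6 (|P(N)| ∼ …, Mitsui 1956, Hinz 1981)] -/
def PrimesAsymptotic (K : Type*) [Field K] [NumberField K] : Prop :=
  Tendsto (fun N : ℝ => (primesA K N : ℝ) * Real.log ((2 * N) ^ finrank ℚ K) /
      (2 * N) ^ finrank ℚ K) atTop
    (𝓝 (Units.torsionOrder K / (2 ^ finrank ℚ K * classNumber K * Units.regulator K) *
      (1 - 2⁻¹ ^ finrank ℚ K)))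

/-- **`Δ = 1`** for totally real `K` under `PrimesAsymptotic` (the end of the proof of Corollary 2.6,
`BoundedGapsNumberFieldsProofs.tendsto_delta_totallyReal` fed with `tendsto_cardA_div`).
[cite: CastilloEtAl2015, proof of Corollary 2.6 (Δ = 1)] -/
theorem tendsto_delta_of_primesAsymptotic [IsTotallyReal K] (hP : PrimesAsymptotic K) :
    Tendsto (fun N : ℝ => dedekindZeta_residue K *
      ((primesA K N : ℝ) * Real.log (cardA K N) / cardA K N)) atTop (𝓝 1) :=
  CastilloEtAl2015.tendsto_delta_totallyReal K (cardA := fun N => (cardA K N : ℝ))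
    (cardP := fun N => (primesA K N : ℝ)) tendsto_cardA_div hP

end Literature.NumberTheory.Sieve.MaynardNF
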